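import Summits.AtomisticToContinuum.HydrodynamicLimit.Theorems.LambertianContactSwapContactAngleEquidistributionCampbellHitSum
import Summits.AtomisticToContinuum.HydrodynamicLimit.Theorems.LambertianContactSwapContactAngleEquidistributionNearFieldTools
import HarnessLib

/-!
# Campbell's formula with TIME-DEPENDENT marks for `hit`-sums over Alexander's construction under
# the homogeneous Gibbs law (sub-goal `stub_campbellTimeDep`, line `Sketch`, crux
# `LambertianContactSwap.ContactAngleEquidistribution`, stmt-AtomisticToContinuum-12097)

The crux functional is a MARKED HIT-SUM over the collision-by-collision construction of the
hard-sphere flow on `T³` (`Literature.Analysis.FluidPDE.HardSphereFlowConstruction`): collisions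
`m < Kt z t = Alexander.collisionCount z t` are read on the pre-collisional exit configuration
`y_m = zpre z m` through the selector `hit y i j`, and the crux's test functions ALSO read the
collision instant `tcol z m = t_{m+1} ∈ (0, t]`.  `…CampbellHitSum` proves, conditionally on the
named fact `HardSphereCampbellFormula` (Cercignani–Illner–Pulvirenti 1994, App. 4.A), Campbell's
formula for TIME-INDEPENDENT marks; this file proves the time-dependent refinement
(`stub_campbellTimeDep`): for every jointly measurable mark `F (s, y, i, j) ≥ 0`,
`E_Q[Σ_{m < Kt z t} Σ_{ij} [hit y_m i j] F (tcol z m, y_m, i, j)]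
   = ∫_{s ∈ (0, t]} outgoingCollisionFlux (ρ_N · [i < j] F (s, collidePair i j ·, i, j)) ds`
(Campbell's theorem for the stationary marked point process of collision instants).

Proof.  ABSTRACT PART (`lintegral_sum_range_timeDep`): for a count `K ω s`, instants `T ω m` and
marks `Y ω m` with (i) a.s. `m < K ω s ↔ T ω m ∈ (0, s]` (`s ≥ 0`), (ii) the time-independent
identity `E[Σ_{m < K s} g (Y m)] = s · E[Σ_{m < K 1} g (Y m)]` for measurable `g ≥ 0`, (iii)
`E[K 1] < ∞`, both sides are integrals of the mark against a CAMPBELL MEASURE on `ℝ × Ψ`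
(`lintegral_sum_range_eq_lintegral_sum_map`); the two measures are finite on `(-∞, n] × Ψ` and
agree on the generating π-system of rectangles `(-∞, b] × B` (by (i) and (ii) both give
`β · E[Σ_{m < K 1} 𝟙_B (Y m)]`, `β = max (min t b) 0`, `sum_range_indicator_Iic_prod_eq`), hence
coincide.  CONCRETE PART: (i) is `Alexander.le_collisionCount_iff` on good orbits, (ii) is
`lintegral_hitSum_localGibbsLaw_const` after collapsing the `hit`-selected double sum to the single
colliding pair (`sum_sum_ite_hit_eq`), (iii) is rung 0 of `CollisionMomentBound`
(`collisionMomentBound_const`; whence the prefix `∀ θe > 0, ∃ σ₀` and the family of flows), and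
each frozen-time slice of the right-hand side is the flux by the time-independent formula at time `1`.
NOT here: real-valued / centred marks (`F = F⁺ − F⁻`), any evaluation of the static flux integral.

References: C. Cercignani, R. Illner, M. Pulvirenti, *The Mathematical Theory of Dilute Gases*
(1994), App. 4.A pp. 107–111; A. F. Karr, *Point Processes and Their Statistical Inference*,
Def. 1.61–1.62, Prop. 1.63 (1.72); I. Gallagher, L. Saint-Raymond, B. Texier, *From Newton to
Boltzmann* (2013), §4.1.
-/

noncomputable section

open MeasureTheory Filter Set Topology ProbabilityTheory
open scoped ENNReal BigOperators Classical

namespace Summit.AtomisticToContinuum.HydrodynamicLimit.Theorems.ContactAngleEquidistributionSketch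

open Literature.Analysis.FluidPDE Literature.MathematicalPhysics.KineticTheory
open Summit.AtomisticToContinuum.HydrodynamicLimit.Theorems.LambertianContactSwapCollisionMomentBound

/-- **Windows.**  If `m < K s ↔ T m ∈ (0, s]` for all `s ≥ 0`, then for `t ≥ 0` the sum over
`m < K t` of `𝟙_{(-∞, b] × B} (T m, Y m)` is the sum over `m < K β` of `𝟙_B (Y m)`,
`β = max (min t b) 0` (the instants counted by time `t` and at most `b` are those counted by time
`β`). [folklore] -/
theorem sum_range_indicator_Iic_prod_eq {Ψ : Type*} {K : ℝ → ℕ} {T : ℕ → ℝ}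
    (hwin : ∀ s, 0 ≤ s → ∀ m, m < K s ↔ T m ∈ Ioc 0 s) {t : ℝ} (ht : 0 ≤ t) (b : ℝ)
    (B : Set Ψ) (Y : ℕ → Ψ) : ∑ m ∈ Finset.range (K t), (Iic b ×ˢ B).indicator (1 : ℝ × Ψ → ℝ≥0∞) (T m, Y m) =
      ∑ m ∈ Finset.range (K (max (min t b) 0)), B.indicator 1 (Y m) := by
  set β := max (min t b) 0 with hβ
  have hβ0 : 0 ≤ β := le_max_right _ _
  have hβt : β ≤ t := max_le (min_le_left _ _) ht
  have hKle : K β ≤ K t := by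
    by_contra h
    have h1 := (hwin β hβ0 (K t)).1 (not_le.1 h)
    exact lt_irrefl _ ((hwin t ht (K t)).2 ⟨h1.1, h1.2.trans hβt⟩)
  rw [← Finset.sum_range_add_sum_Ico _ hKle, Finset.sum_eq_zero (s := Finset.Ico (K β) (K t)),
    add_zero]
  · refine Finset.sum_congr rfl fun m hm => ?_
    have hmβ : T m ∈ Ioc 0 β := (hwin β hβ0 m).1 (Finset.mem_range.1 hm)
    have hβpos : 0 < β := hmβ.1.trans_le hmβ.2
    have hTb : T m ≤ b := by
      rcases le_or_gt (min t b) 0 with h | h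
      · exact absurd (hβ.trans (max_eq_right h)) hβpos.ne'
      · exact (hmβ.2.trans_eq (hβ.trans (max_eq_left h.le))).trans (min_le_right _ _)
    by_cases hYB : Y m ∈ B
    · rw [indicator_of_mem (mem_prod.2 ⟨mem_Iic.2 hTb, hYB⟩), indicator_of_mem hYB]
      rfl
    · rw [indicator_of_notMem (fun h => hYB (mem_prod.1 h).2), indicator_of_notMem hYB]
  · -- instants counted after time `β` exceed `b`
    refine fun m hm => indicator_of_notMem (fun hmem => ?_) _
    rw [Finset.mem_Ico] at hm
    have hmt : T m ∈ Ioc 0 t := (hwin t ht m).1 hm.2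
    have hnot : ¬ T m ∈ Ioc 0 β := fun h => (not_lt.2 hm.1) ((hwin β hβ0 m).2 h)
    exact hnot ⟨hmt.1, (le_min hmt.2 (mem_prod.1 hmem).1).trans (le_max_left _ _)⟩

variable {Ω Ψ : Type*} [MeasurableSpace Ω] [MeasurableSpace Ψ]

/-- A sum over `Finset.range (K z)` of measurable `ℝ≥0∞`-valued terms, `K` measurable, is
measurable. [folklore] -/
theorem measurable_sum_range_ennreal {K : Ω → ℕ} (hK : Measurable K) {a : ℕ → Ω → ℝ≥0∞}
    (ha : ∀ m, Measurable (a m)) : Measurable fun z => ∑ m ∈ Finset.range (K z), a m z := by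
  have h : Measurable fun p : Ω × ℕ => ∑ m ∈ Finset.range p.2, a m p.1 := by
    refine measurable_from_prod_countable_left fun k => ?_
    exact Finset.measurable_sum (Finset.range k) fun m _ => ha m
  exact h.comp (measurable_id.prodMk hK)

/-- **The Campbell measure of a marked point sequence.**  For a count `κ`, instants `T · m` and
marks `Y · m` (measurable), `f ↦ ∫⁻ Σ_{m < κ ω} f (T ω m, Y ω m) dQ` is the integral of `f` against
the measure `Σ_m (T · m, Y · m)_* (Q|_{m < κ})` on `ℝ × Ψ` (Tonelli for the countable sum, change of
variables for each push-forward). [cite: Karr2017, Def. 1.61–1.62] -/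
theorem lintegral_sum_range_eq_lintegral_sum_map (Q : Measure Ω) {κ : Ω → ℕ} (hκ : Measurable κ)
    {T : Ω → ℕ → ℝ} (hT : ∀ m, Measurable fun ω => T ω m) {Y : Ω → ℕ → Ψ}
    (hY : ∀ m, Measurable fun ω => Y ω m) {f : ℝ × Ψ → ℝ≥0∞} (hf : Measurable f) :
    ∫⁻ ω, ∑ m ∈ Finset.range (κ ω), f (T ω m, Y ω m) ∂Q =
      ∫⁻ x, f x ∂(Measure.sum fun m => (Q.restrict {ω | m < κ ω}).map fun ω => (T ω m, Y ω m)) := by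
  have hS : ∀ m, MeasurableSet {ω | m < κ ω} := fun m => measurableSet_lt measurable_const hκ
  rw [lintegral_sum_measure]
  have h1 : ∀ m, ∫⁻ x, f x ∂((Q.restrict {ω | m < κ ω}).map fun ω => (T ω m, Y ω m)) =
      ∫⁻ ω, {ω | m < κ ω}.indicator (fun ω => f (T ω m, Y ω m)) ω ∂Q := fun m => by
    rw [lintegral_map hf ((hT m).prodMk (hY m)), lintegral_indicator (hS m)]
  simp_rw [h1]
  have h2 : ∀ m, Measurable fun ω => {ω | m < κ ω}.indicator (fun ω => f (T ω m, Y ω m)) ω :=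
    fun m => (hf.comp ((hT m).prodMk (hY m))).indicator (hS m)
  rw [← lintegral_tsum fun m => (h2 m).aemeasurable]
  refine lintegral_congr fun ω => ?_
  rw [tsum_eq_sum (s := Finset.range (κ ω)) fun m hm => ?_]
  · refine Finset.sum_congr rfl fun m hm => ?_
    exact (indicator_of_mem (show ω ∈ {ω | m < κ ω} from Finset.mem_range.1 hm)
      fun ω => f (T ω m, Y ω m)).symm
  · exact indicator_of_notMem (show ω ∉ {ω | m < κ ω} from fun h => hm (Finset.mem_range.2 h)) _

/-- **Campbell's theorem with time-dependent marks, abstract form** (Karr, Prop. 1.63 (1.72), for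
the marked point sequence `(T ω m, Y ω m)_m` counted by `K ω s`).  Assume: a.s.
`m < K ω s ↔ T ω m ∈ (0, s]` for all `s ≥ 0`; `E[Σ_{m < K s} g (Y m)] = s · E[Σ_{m < K 1} g (Y m)]`
for all `s ≥ 0` and measurable `g ≥ 0` (stationarity); `E[K 1] < ∞`.  Then for `t ≥ 0` and every
jointly measurable `f ≥ 0`, `E[Σ_{m < K t} f (T m, Y m)] = ∫_{(0, t]} E[Σ_{m < K 1} f (s, Y m)] ds`
(the two Campbell measures are finite on `(-∞, n] × Ψ` and agree on the rectangles `(-∞, b] × B`).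
[cite: Karr2017, Prop. 1.63 (1.72)] -/
theorem lintegral_sum_range_timeDep (Q : Measure Ω) [SFinite Q] {K : Ω → ℝ → ℕ} {T : Ω → ℕ → ℝ}
    {Y : Ω → ℕ → Ψ} (hK : ∀ s, Measurable fun ω => K ω s) (hT : ∀ m, Measurable fun ω => T ω m)
    (hY : ∀ m, Measurable fun ω => Y ω m)
    (hwin : ∀ᵐ ω ∂Q, ∀ s, 0 ≤ s → ∀ m, m < K ω s ↔ T ω m ∈ Ioc 0 s)
    (hstat : ∀ s, 0 ≤ s → ∀ g : Ψ → ℝ≥0∞, Measurable g →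
      ∫⁻ ω, ∑ m ∈ Finset.range (K ω s), g (Y ω m) ∂Q =
        ENNReal.ofReal s * ∫⁻ ω, ∑ m ∈ Finset.range (K ω 1), g (Y ω m) ∂Q)
    (hfin : ∫⁻ ω, ((K ω 1 : ℕ) : ℝ≥0∞) ∂Q ≠ ⊤) {t : ℝ} (ht : 0 ≤ t) {f : ℝ × Ψ → ℝ≥0∞}
    (hf : Measurable f) :
    ∫⁻ ω, ∑ m ∈ Finset.range (K ω t), f (T ω m, Y ω m) ∂Q =
      ∫⁻ s in Ioc 0 t, ∫⁻ ω, ∑ m ∈ Finset.range (K ω 1), f (s, Y ω m) ∂Q := by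
  -- the two Campbell measures on `ℝ × Ψ` (Tonelli on `(0, t] × Ω` for the second one)
  set μ₁ : Measure (ℝ × Ψ) :=
    Measure.sum fun m => (Q.restrict {ω | m < K ω t}).map fun ω => (T ω m, Y ω m) with hμ₁
  set μ₂ : Measure (ℝ × Ψ) := Measure.sum fun m =>
    (((volume.restrict (Ioc 0 t)).prod Q).restrict {p : ℝ × Ω | m < K p.2 1}).map
      fun p => (p.1, Y p.2 m) with hμ₂
  have hrep1 : ∀ {g : ℝ × Ψ → ℝ≥0∞}, Measurable g →
      ∫⁻ ω, ∑ m ∈ Finset.range (K ω t), g (T ω m, Y ω m) ∂Q = ∫⁻ x, g x ∂μ₁ := fun hg =>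
    lintegral_sum_range_eq_lintegral_sum_map Q (hK t) hT hY hg
  have hrep2 : ∀ {g : ℝ × Ψ → ℝ≥0∞}, Measurable g →
      ∫⁻ s in Ioc 0 t, ∫⁻ ω, ∑ m ∈ Finset.range (K ω 1), g (s, Y ω m) ∂Q = ∫⁻ x, g x ∂μ₂ := by
    intro g hg
    have hm : Measurable fun p : ℝ × Ω => ∑ m ∈ Finset.range (K p.2 1), g (p.1, Y p.2 m) :=
      measurable_sum_range_ennreal ((hK 1).comp measurable_snd) fun m =>
        hg.comp (measurable_fst.prodMk ((hY m).comp measurable_snd))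
    rw [← lintegral_prod _ hm.aemeasurable]
    exact lintegral_sum_range_eq_lintegral_sum_map _ ((hK 1).comp measurable_snd)
      (fun _ => measurable_fst) (fun m => (hY m).comp measurable_snd) hg
  rw [hrep1 hf, hrep2 hf]
  suffices hμ : μ₁ = μ₂ by rw [hμ]
  -- total mass: `μ₁ univ = E[K t] = t · E[K 1] < ∞`
  have hμ₁univ : μ₁ univ ≠ ⊤ := by
    have h : ∫⁻ ω, ∑ m ∈ Finset.range (K ω t), (1 : ℝ≥0∞) ∂Q = ∫⁻ x, (1 : ℝ≥0∞) ∂μ₁ :=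
      hrep1 (g := fun _ => 1) measurable_const
    have h' := hstat t ht (fun _ => 1) measurable_const
    simp only [Finset.sum_const, Finset.card_range, nsmul_eq_mul, mul_one] at h h'
    rw [← lintegral_one, ← h, h']
    exact ENNReal.mul_ne_top ENNReal.ofReal_ne_top hfin
  -- the generating π-system of rectangles `(-∞, b] × B`
  have hUnionIic : ⋃ n : ℕ, Iic (n : ℝ) = univ :=
    iUnion_eq_univ_iff.2 fun x => ⟨⌈x⌉₊, mem_Iic.2 (Nat.le_ceil x)⟩
  refine Measure.ext_of_generateFrom_of_iUnion
    (image2 (· ×ˢ ·) (range Iic) {B : Set Ψ | MeasurableSet B}) (fun n : ℕ => Iic (n : ℝ) ×ˢ univ)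
    (generateFrom_eq_prod ((BorelSpace.measurable_eq (α := ℝ)).trans
      (borel_eq_generateFrom_Iic ℝ)).symm MeasurableSpace.generateFrom_measurableSet
      ⟨fun n : ℕ => Iic (n : ℝ), fun n => mem_range_self _, hUnionIic⟩
      isCountablySpanning_measurableSet).symm
    (isPiSystem_Iic.prod MeasurableSpace.isPiSystem_measurableSet) ?_
    (fun n => mem_image2_of_mem (mem_range_self _) MeasurableSet.univ)
    (fun n => ne_top_of_le_ne_top hμ₁univ (measure_mono (subset_univ _))) ?_
  · rw [← iUnion_prod_const, hUnionIic, univ_prod_univ]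
  rintro _ ⟨_, ⟨b, rfl⟩, B, hB, rfl⟩
  show μ₁ (Iic b ×ˢ B) = μ₂ (Iic b ×ˢ B)
  have hR : MeasurableSet (Iic b ×ˢ B) := measurableSet_Iic.prod hB
  rw [← lintegral_indicator_one hR, ← lintegral_indicator_one hR,
    ← hrep1 (measurable_one.indicator hR), ← hrep2 (measurable_one.indicator hR)]
  set β : ℝ := max (min t b) 0 with hβdef
  -- left: the window identity pathwise, then stationarity at time `β`
  have hL : ∫⁻ ω, ∑ m ∈ Finset.range (K ω t),
      (Iic b ×ˢ B).indicator (1 : ℝ × Ψ → ℝ≥0∞) (T ω m, Y ω m) ∂Q =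
      ENNReal.ofReal β * ∫⁻ ω, ∑ m ∈ Finset.range (K ω 1), B.indicator 1 (Y ω m) ∂Q := by
    rw [← hstat β (le_max_right _ _) _ (measurable_one.indicator hB)]
    exact lintegral_congr_ae (hwin.mono fun ω hω => sum_range_indicator_Iic_prod_eq hω ht b B (Y ω))
  -- right: the frozen-time factor integrates to `volume ((-∞, b] ∩ (0, t]) = β`
  have hvol : volume (Iic b ∩ Ioc 0 t) = ENNReal.ofReal β := by
    rcases le_total b t with hbt | htb
    · rw [Iic_inter_Ioc_of_le hbt, Real.volume_Ioc, sub_zero, hβdef, min_eq_right hbt]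
      rcases le_total b 0 with hb0 | hb0
      · rw [max_eq_right hb0, ENNReal.ofReal_of_nonpos hb0, ENNReal.ofReal_zero]
      · rw [max_eq_left hb0]
    · rw [inter_eq_right.2 (Ioc_subset_Iic_self.trans (Iic_subset_Iic.2 htb)), Real.volume_Ioc,
        sub_zero, hβdef, min_eq_left htb, max_eq_left ht]
  have hR' : ∫⁻ s in Ioc 0 t, ∫⁻ ω, ∑ m ∈ Finset.range (K ω 1),
      (Iic b ×ˢ B).indicator (1 : ℝ × Ψ → ℝ≥0∞) (s, Y ω m) ∂Q =
      ENNReal.ofReal β * ∫⁻ ω, ∑ m ∈ Finset.range (K ω 1), B.indicator 1 (Y ω m) ∂Q := by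
    have hin : ∀ s : ℝ, ∫⁻ ω, ∑ m ∈ Finset.range (K ω 1),
        (Iic b ×ˢ B).indicator (1 : ℝ × Ψ → ℝ≥0∞) (s, Y ω m) ∂Q =
        (Iic b).indicator 1 s * ∫⁻ ω, ∑ m ∈ Finset.range (K ω 1), B.indicator 1 (Y ω m) ∂Q := by
      intro s
      simp_rw [indicator_prod_one, ← Finset.mul_sum]
      exact lintegral_const_mul _ (measurable_sum_range_ennreal (hK 1) fun m =>
        (measurable_one.indicator hB).comp (hY m))
    simp_rw [hin]
    rw [lintegral_mul_const _ (measurable_one.indicator measurableSet_Iic),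
      lintegral_indicator_one measurableSet_Iic, Measure.restrict_apply measurableSet_Iic, hvol]
  exact hL.trans hR'.symm

section Flow

variable {d : Type*} [Fintype d] {X : Type*} {N : ℕ} {G : Geometry d X} {ε : ℝ}
  [MeasureSpace X] [TopologicalSpace X] [T2Space X]

/-- A good datum of a hard-sphere flow in a regular Hausdorff geometry is forward-good for
Alexander's construction and has positive first exit time (its orbit is a hard-sphere trajectory
through it at time `0`). [folklore] -/
theorem fwdGood_and_freeExitTime_pos (hG : G.IsHardSphereRegular ε) (Φ : HardSphereFlow G ε N)
    {z : Config N d X} (hz : z ∈ Φ.good) :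
    Alexander.FwdGood G ε z ∧ 0 < Alexander.freeExitTime G ε z := by
  have hγ : IsHardSphereTrajectory G ε N fun s => Φ.flow s z := Φ.isTrajectory z hz
  have h1 := hγ.fwdGood_apply_zero hG; have h2 := hγ.freeExitTime_apply_pos hG 0
  beta_reduce at h1 h2
  rw [Φ.flow_zero z hz] at h1 h2
  exact ⟨h1, h2⟩

/-- For `m < collisionCount z t` along a good orbit, the pre-collisional exit configuration
`y_m = S_{τ(z_m)} z_m` is a simple incoming collision configuration (the instant `t_{m+1} ≤ t` is
finite, so the `m`-th free flight ends; `Alexander.FwdGood.exists_stateAfter_succ`). [folklore] -/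
theorem exists_isSimpleIncomingWith_of_mem_range (hG : G.IsHardSphereRegular ε)
    (Φ : HardSphereFlow G ε N) {z : Config N d X} (hz : z ∈ Φ.good) {t : ℝ} {m : ℕ}
    (hm : m ∈ Finset.range (Alexander.collisionCount G ε z t)) :
    ∃ p, Alexander.IsSimpleIncomingWith G ε
      (freeFlight G (Alexander.freeExitTime G ε (Alexander.stateAfter G ε z m)).toReal
        (Alexander.stateAfter G ε z m)) p := by
  have hfwd := (fwdGood_and_freeExitTime_pos hG Φ hz).1
  have hfin : Alexander.collisionInstant G ε z (m + 1) ≠ ∞ :=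
    ne_top_of_le_ne_top ENNReal.ofReal_ne_top
      ((Alexander.le_collisionCount_iff hfwd).1 (Nat.succ_le_of_lt (Finset.mem_range.1 hm)))
  rw [Alexander.collisionInstant_succ, ENNReal.add_ne_top] at hfin
  obtain ⟨p, hp, -⟩ := hfwd.exists_stateAfter_succ hfin.2
  exact ⟨p, hp⟩

/-- **The collisions counted by time `s` are those with instant in `(0, s]`**: along a good orbit,
for `s ≥ 0`, `m < collisionCount z s ↔ toReal t_{m+1} ∈ (0, s]` (`Alexander.le_collisionCount_iff`;
`t_{m+1} ≥ t_1 = τ(z) > 0`, and an infinite instant is never counted). [folklore] -/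
theorem lt_collisionCount_iff_mem_Ioc (hG : G.IsHardSphereRegular ε) (Φ : HardSphereFlow G ε N)
    {z : Config N d X} (hz : z ∈ Φ.good) {s : ℝ} (hs : 0 ≤ s) (m : ℕ) :
    m < Alexander.collisionCount G ε z s ↔
      (Alexander.collisionInstant G ε z (m + 1)).toReal ∈ Ioc 0 s := by
  obtain ⟨hfwd, h0⟩ := fwdGood_and_freeExitTime_pos hG Φ hz
  have hpos : 0 < Alexander.collisionInstant G ε z (m + 1) :=
    calc (0 : ℝ≥0∞) < Alexander.freeExitTime G ε z := h0
      _ = Alexander.collisionInstant G ε z 1 := (Alexander.collisionInstant_one _).symm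
      _ ≤ Alexander.collisionInstant G ε z (m + 1) :=
          Alexander.monotone_collisionInstant _ (Nat.succ_le_succ (Nat.zero_le m))
  rw [Nat.lt_iff_add_one_le, Alexander.le_collisionCount_iff hfwd, mem_Ioc]
  constructor
  · intro hle
    have hfin := ne_top_of_le_ne_top ENNReal.ofReal_ne_top hle
    exact ⟨ENNReal.toReal_pos hpos.ne' hfin, ENNReal.toReal_le_of_le_ofReal hs hle⟩
  · rintro ⟨hp, hle⟩
    have hfin : Alexander.collisionInstant G ε z (m + 1) ≠ ∞ := fun h => by
      rw [h, ENNReal.toReal_top] at hp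
      exact lt_irrefl 0 hp
    rw [← ENNReal.ofReal_toReal hfin]
    exact ENNReal.ofReal_le_ofReal hle

end Flow

/-- **The collision count on `[0, 1]` has finite mean under the homogeneous Gibbs law** (`∀ N`, for
`0 < σ < σ₀(θe)`): rung 0 of `CollisionMomentBound` (`collisionMomentBound_const`) bounds the mean of
the normalised `|g|³`-weighted hit-sum, and on good orbits each counted collision contributes
`1 + |g|³ ≥ 1` to it (`sum_sum_ite_hit_eq`). [folklore] -/
theorem exists_sigma_lintegral_collisionCount_ne_top {θe : ℝ} (hθe : 0 < θe) :
    ∃ σ₀ : ℝ, 0 < σ₀ ∧ ∀ σ : ℝ, 0 < σ → σ < σ₀ →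
      ∀ Φ : (N : ℕ) → HardSphereFlow (Torus.geometry (Fin 3)) (hsDiameter σ N) (N + 1), ∀ N : ℕ,
        ∫⁻ z, ((Alexander.collisionCount (Torus.geometry (Fin 3)) (hsDiameter σ N) z 1 : ℕ) : ℝ≥0∞)
          ∂(localGibbsLaw σ (fun _ => 1) (fun _ => 0) (fun _ => θe) N (Φ N)) ≠ ⊤ := by
  obtain ⟨σ₀, hσ₀, hrung⟩ := collisionMomentBound_const one_pos hθe (0 : V3)
  refine ⟨min σ₀ 2⁻¹, lt_min hσ₀ (by norm_num), fun σ hσ hσlt Φ N => ?_⟩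
  have hσ2 : σ < 2⁻¹ := hσlt.trans_le (min_le_right _ _)
  obtain ⟨C, hCb⟩ := hrung σ hσ (hσlt.trans_le (min_le_left _ _)) Φ 1 zero_le_one
  have hb := hCb N
  set c : ℝ := ((N : ℝ) + 1) ^ (-(4 / 3 : ℝ)) with hc
  have hcpos : 0 < c := Real.rpow_pos_of_pos (by positivity) _
  have hG : (Torus.geometry (Fin 3)).IsHardSphereRegular (hsDiameter σ N) :=
    Torus.isHardSphereRegular_geometry ((hsDiameter_le hσ.le N).trans_lt hσ2)
  refine ne_top_of_le_ne_top (ENNReal.mul_ne_top (ENNReal.ofReal_ne_top : ENNReal.ofReal c⁻¹ ≠ ⊤)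
    (ne_top_of_le_ne_top ENNReal.ofReal_ne_top hb)) ?_
  rw [← lintegral_const_mul' _ _ ENNReal.ofReal_ne_top]
  refine lintegral_mono_ae ((ae_mem_good_localGibbsLaw σ _ _ _ N (Φ N)).mono fun z hz => ?_)
  rw [← ENNReal.ofReal_mul (inv_nonneg.2 hcpos.le), ← mul_assoc, inv_mul_cancel₀ hcpos.ne', one_mul,
    ← ENNReal.ofReal_natCast]
  refine ENNReal.ofReal_le_ofReal ?_
  calc ((Alexander.collisionCount (Torus.geometry (Fin 3)) (hsDiameter σ N) z 1 : ℕ) : ℝ)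
      = ∑ m ∈ Finset.range (Alexander.collisionCount (Torus.geometry (Fin 3)) (hsDiameter σ N) z 1),
          (1 : ℝ) := by simp
    _ ≤ _ := Finset.sum_le_sum fun m hm => ?_
  obtain ⟨p, hp⟩ := exists_isSimpleIncomingWith_of_mem_range hG (Φ N) hz hm
  refine le_of_le_of_eq ?_ (sum_sum_ite_hit_eq hp fun y i j => 1 + ‖(y i).2 - (y j).2‖ ^ 3).symm
  exact le_add_of_nonneg_right (by positivity)

/-- **Registered sub-goal `stub_campbellTimeDep`** (line `Sketch`, crux ContactAngleEquidistribution,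
stmt-AtomisticToContinuum-12097): CAMPBELL'S FORMULA WITH TIME-DEPENDENT MARKS for `hit`-sums over
Alexander's construction under the homogeneous Gibbs law, in the crux's `let`-encoding.
Conditional on the named fact `HardSphereCampbellFormula`: for every `θe > 0` there is `σ₀ > 0`
such that for `0 < σ < σ₀`, every family of hard-sphere flow structures `Φ`, every `t ≥ 0`, every
`N` and every jointly measurable `ℝ≥0∞`-valued mark `F (s, y, i, j)` of (collision instant,
pre-collisional configuration, ordered pair),
`∫⁻ Σ_{m < Kt z t} Σ_i Σ_j [hit (zpre z m) i j] F (tcol z m) (zpre z m) i j ∂Q_N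
   = ∫⁻_{s ∈ (0, t]} outgoingCollisionFlux (ε σ N) (N+1) (ρ_N · [i < j] F s (collidePair i j ·) i j)`,
`ρ_N` the Liouville density of `Q_N = localGibbsLaw σ 1 0 θe N (Φ N)` (`lintegral_sum_range_timeDep`
for the summed mark `f (s, y) = Σ_{ij} [hit y i j] F s y i j`). [cite: CIP1994, App. 4.A pp. 107–111] -/
theorem stub_campbellTimeDep (hC : HardSphereCampbellFormula) :
    let Cfg : ℕ → Type := fun N => Config (N + 1) (Fin 3) T3
    let G := Torus.geometry (Fin 3)
    let ε : ℝ → ℕ → ℝ := hsDiameter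
    let τ : ℝ → (N : ℕ) → Cfg N → ℝ≥0∞ := fun σ N z => Alexander.freeExitTime G (ε σ N) z
    let S : ℝ → (N : ℕ) → Cfg N → Cfg N := fun t _ z => freeFlight G t z
    let zpre : ℝ → (N : ℕ) → Cfg N → ℕ → Cfg N := fun σ N z m =>
      let y := Alexander.stateAfter G (ε σ N) z m; S (τ σ N y).toReal N y
    let Kt : ℝ → (N : ℕ) → Cfg N → ℝ → ℕ := fun σ N z t => Alexander.collisionCount G (ε σ N) z t
    let hit : ℝ → (N : ℕ) → Cfg N → Fin (N + 1) → Fin (N + 1) → Prop := fun σ N y i j =>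
      i < j ∧ y ∈ contactSet G (N + 1) (ε σ N) i j ∧ IsIncoming G y i j
    let tcol : ℝ → (N : ℕ) → Cfg N → ℕ → ℝ := fun σ N z m =>
      (Alexander.collisionInstant G (ε σ N) z (m + 1)).toReal
    ∀ θe : ℝ, 0 < θe → ∃ σ₀ : ℝ, 0 < σ₀ ∧ ∀ σ : ℝ, 0 < σ → σ < σ₀ →
      ∀ Φ : (N : ℕ) → HardSphereFlow G (ε σ N) (N + 1),
      let Q := fun N => localGibbsLaw σ (fun _ => 1) (fun _ => 0) (fun _ => θe) N (Φ N)
      ∀ t : ℝ, 0 ≤ t → ∀ (N : ℕ) (F : ℝ → Cfg N → Fin (N + 1) → Fin (N + 1) → ℝ≥0∞),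
        (∀ i j, Measurable fun p : ℝ × Cfg N => F p.1 p.2 i j) →
        ∫⁻ z, (∑ m ∈ Finset.range (Kt σ N z t), ∑ i : Fin (N + 1), ∑ j : Fin (N + 1),
            (let y := zpre σ N z m
             if hit σ N y i j then F (tcol σ N z m) y i j else 0)) ∂(Q N) =
          ∫⁻ s in Set.Ioc 0 t, outgoingCollisionFlux (ε σ N) (N + 1) (fun w i j =>
            ENNReal.ofReal (canonicalDensity G (ε σ N) (N + 1)
              (localGibbsProfile (fun _ => 1) (fun _ => 0) (fun _ => θe)) w) *
            (if i < j then F s (collidePair G i j w) i j else 0)) := by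
  intro Cfg G ε τ S zpre Kt hit tcol θe hθe
  obtain ⟨σ₁, hσ₁, hfinσ⟩ := exists_sigma_lintegral_collisionCount_ne_top hθe
  refine ⟨min σ₁ (1 / 2), lt_min hσ₁ (by norm_num), fun σ hσ hσlt Φ => ?_⟩
  intro Q t ht N F hF
  have hσh : σ < 1 / 2 := hσlt.trans_le (min_le_right _ _)
  have hσ2 : σ < 2⁻¹ := by rwa [← one_div]
  have hG : (Torus.geometry (Fin 3)).IsHardSphereRegular (hsDiameter σ N) :=
    Torus.isHardSphereRegular_geometry ((hsDiameter_le hσ.le N).trans_lt hσ2)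
  haveI : IsProbabilityMeasure (Q N) := isProbabilityMeasure_localGibbsLaw continuous_const
    continuous_const continuous_const (fun _ => one_pos) (fun _ => hθe) hσh.le N (Φ N)
  have hgood : ∀ᵐ z ∂(Q N), z ∈ (Φ N).good := ae_mem_good_localGibbsLaw σ _ _ _ N (Φ N)
  -- the summed, jointly measurable mark
  set f : ℝ × Cfg N → ℝ≥0∞ := fun p =>
    ∑ i : Fin (N + 1), ∑ j : Fin (N + 1), if hit σ N p.2 i j then F p.1 p.2 i j else 0 with hfdef
  have hfm : Measurable f := by
    refine Finset.measurable_sum _ fun i _ => Finset.measurable_sum _ fun j _ => ?_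
    exact Measurable.ite (NearField.measurableSet_hit (ε σ N) measurable_snd i j) (hF i j)
      measurable_const
  -- stationarity: the time-independent Campbell identity for an arbitrary measurable mark `g (y_m)`
  have hstat : ∀ s, 0 ≤ s → ∀ g : Cfg N → ℝ≥0∞, Measurable g →
      ∫⁻ z, ∑ m ∈ Finset.range (Kt σ N z s), g (zpre σ N z m) ∂(Q N) =
        ENNReal.ofReal s * ∫⁻ z, ∑ m ∈ Finset.range (Kt σ N z 1), g (zpre σ N z m) ∂(Q N) := by
    intro s hs g hg
    have e : ∀ u : ℝ, 0 ≤ u → ∫⁻ z, ∑ m ∈ Finset.range (Kt σ N z u), g (zpre σ N z m) ∂(Q N) =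
        ENNReal.ofReal u * outgoingCollisionFlux (ε σ N) (N + 1) (fun w i j =>
          ENNReal.ofReal (canonicalDensity G (ε σ N) (N + 1)
            (localGibbsProfile (fun _ => 1) (fun _ => 0) (fun _ => θe)) w) *
          (if i < j then g (collidePair G i j w) else 0)) := by
      intro u hu
      refine (lintegral_congr_ae (hgood.mono fun z hz => ?_)).trans
        (lintegral_hitSum_localGibbsLaw_const hC hσ hσh θe N (Φ N) hu (fun y _ _ => g y)
          fun _ _ => hg)
      refine Finset.sum_congr rfl fun m hm => ?_
      obtain ⟨p, hp⟩ := exists_isSimpleIncomingWith_of_mem_range hG (Φ N) hz hm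
      exact (sum_sum_ite_hit_eq hp fun y _ _ => g y).symm
    rw [e s hs, e 1 zero_le_one, ENNReal.ofReal_one, one_mul]
  have key := lintegral_sum_range_timeDep (Q N) (K := Kt σ N) (T := tcol σ N) (Y := zpre σ N)
    (fun s => NearField.measurable_Kt hσ hσ2 N s) (fun m => NearField.measurable_tcol hσ hσ2 N m)
    (fun m => NearField.measurable_zpre hσ hσ2 N m)
    (hgood.mono fun z hz s hs m => lt_collisionCount_iff_mem_Ioc hG (Φ N) hz hs m) hstat
    (hfinσ σ hσ (hσlt.trans_le (min_le_left _ _)) Φ N) ht hfm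
  refine key.trans (lintegral_congr fun s => ?_)
  -- each frozen-time slice of the right-hand side is the outgoing flux (Campbell at time `1`)
  have h1 := lintegral_hitSum_localGibbsLaw_const hC hσ hσh θe N (Φ N) zero_le_one (F s)
    fun i j => (hF i j).comp measurable_prodMk_left
  rw [ENNReal.ofReal_one, one_mul] at h1
  exact h1

end Summit.AtomisticToContinuum.HydrodynamicLimit.Theorems.ContactAngleEquidistributionSketch

end
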